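import Summits.KontsevichZagierPeriods.KontsevichZagierPeriods.Theses.ValuedFieldSpecialisation

/-!
# KontsevichZagierPeriods / ValuedFieldSpecialisation — assembly

Problem `KontsevichZagierPeriods`, route `ValuedFieldSpecialisation`; settles the assembly item
stmt-KontsevichZagierPeriods-3499 (`Assembly`):
`CTConstruction → ParametricLifting → KontsevichZagierPeriods`.

The proof is pure algebra in the free abelian group `KZ.FormalRep` modulo the move subgroup
`KZ.relations`. Given rational representations `r`, `r'` with equal value, `ParametricLifting`
supplies `G = Σ mᵢ [Rᵢ]` in the subgroup generated by the FIBRED move generators, each `Rᵢ` a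
dominated family with special fibre `r₀ᵢ`, and `Σ mᵢ [r₀ᵢ] − ([r] − [r']) ∈ relations`.
Clause (CT2) of `CTConstruction` together with `AddSubgroup.closure_le` (the fibred subgroup lies
in the preimage of `relations` under the additive map `CT`) gives `CT G ∈ relations`; additivity of
`CT` and clause (CT3) give `CT G − Σ mᵢ [r₀ᵢ] ∈ relations`; subtracting twice yields
`[r] − [r'] ∈ relations`, i.e. `KZ.Equivalent r r'`, which is the summit unfolded
(`KontsevichZagierPeriods_iff`). Clause (CT1) (values of `CT`) is not used.

Both hypotheses are OPEN route theses (`CTConstruction` is the thesis-bearing crux,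
`ParametricLifting` the open core of Conjecture-1 strength); this file is the conditional glue only
and is self-contained (it does not invoke the gate-rendered deciding theorem of the Theses file).

Sources: M. Kontsevich, D. Zagier, *Periods* (2001), §1.2 (Conjecture 1); the assembly itself is
elementary.
-/

namespace Summit.KontsevichZagierPeriods.ValuedFieldSpecialisation

/-- Route ValuedFieldSpecialisation, item stmt-KontsevichZagierPeriods-3499 (`Assembly`):
`CTConstruction → ParametricLifting → KontsevichZagierPeriods`. For rational `r`, `r'` with equal
value, `ParametricLifting` gives a fibred relation `G = Σ mᵢ [Rᵢ]` of dominated families with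
special fibres `r₀ᵢ` and `Σ mᵢ [r₀ᵢ] − ([r] − [r']) ∈ KZ.relations`; (CT2) and
`AddSubgroup.closure_le` give `CT G ∈ relations`, (CT3) and additivity give
`CT G − Σ mᵢ [r₀ᵢ] ∈ relations`, hence `[r] − [r'] ∈ relations`, i.e. `KZ.Equivalent r r'`.
[Kontsevich–Zagier 2001, §1.2] [folklore] -/
theorem assembly_proof :
    Summit.KontsevichZagierPeriods.KontsevichZagierPeriods.Theses.ValuedFieldSpecialisation.Assembly := by
  unfold Summit.KontsevichZagierPeriods.KontsevichZagierPeriods.Theses.ValuedFieldSpecialisation.Assembly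
  intro h₁ h₂ n m r r' hr hr' hval
  change Literature.NumberTheory.Transcendental.KZ.of r - Literature.NumberTheory.Transcendental.KZ.of r' ∈
    Literature.NumberTheory.Transcendental.KZ.relations
  obtain ⟨CT, -, hCT2, hCT3⟩ := h₁
  obtain ⟨G, hG, k, d, c, R, r₀, g, hdom, rfl, hfib⟩ := h₂ r r' hr hr' hval
  -- (CT2): the fibred generators go to relations, hence so does the fibred subgroup
  have hCTG : CT (∑ i, c i • Literature.NumberTheory.Transcendental.KZ.of (R i)) ∈
      Literature.NumberTheory.Transcendental.KZ.relations := by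
    have hle : AddSubgroup.closure _ ≤
        Literature.NumberTheory.Transcendental.KZ.relations.comap CT :=
      (AddSubgroup.closure_le _).mpr fun x hx => AddSubgroup.mem_comap.mpr (hCT2 x hx)
    exact AddSubgroup.mem_comap.mp (hle hG)
  -- (CT3): each dominated family specialises to its special fibre modulo relations
  have hCTG' : CT (∑ i, c i • Literature.NumberTheory.Transcendental.KZ.of (R i)) -
      ∑ i, c i • Literature.NumberTheory.Transcendental.KZ.of (r₀ i) ∈
      Literature.NumberTheory.Transcendental.KZ.relations := by
    rw [map_sum, ← Finset.sum_sub_distrib]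
    refine sum_mem fun i _ => ?_
    rw [map_zsmul, ← zsmul_sub]
    exact AddSubgroup.zsmul_mem _ (hCT3 (d i) (R i) (r₀ i) (g i) (hdom i)) (c i)
  -- [r] - [r'] = (CT G - (CT G - Σ mᵢ[r₀ᵢ])) - (Σ mᵢ[r₀ᵢ] - ([r] - [r']))
  have h3 := Literature.NumberTheory.Transcendental.KZ.relations.sub_mem hCTG hCTG'
  rw [sub_sub_cancel] at h3
  have h4 := Literature.NumberTheory.Transcendental.KZ.relations.sub_mem h3 hfib
  rwa [sub_sub_cancel] at h4

end Summit.KontsevichZagierPeriods.ValuedFieldSpecialisation
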